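import Summits.ValiantsHypothesis.ValiantsHypothesis.Theorems.PolyaContinuedMonotoneCoverHardBetCalibration
import Summits.ValiantsHypothesis.ValiantsHypothesis.Theorems.PolyaContinuedMonotoneCoverHardStubRectangleBound

/-!
# Crux `MonotoneCoverHard` (stmt-ValiantsHypothesis-7421), line `few-state-cut`: the bet is EQUIVALENT to
(weakly-exponential Pfaffian-cover size bound) ∧ (a balanced vertex cut exists)

Closure of the calibration file `PolyaContinuedMonotoneCoverHardBetCalibration.lean` (val-width-7421-p2
g0, 2026-08-27): the two hypotheses left open there are discharged from the tree —
`RECT` is val-width-7421-p1's landed `MonotoneCoverHardRectangle.stub_rectangleBound`, and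
`COUNT` (`#{weight-nonzero perfect matchings} ≤ n!`) follows from p1's `label_bijection`
(`card_good_le_factorial` below).  Result:

* `stub_fewStateCut_iff_weakExp_and_balEx` — the (repaired, registered) statement of `stub_fewStateCut`
  is EQUIVALENT to `WEAKEXP ∧ BALEX`:
  `WEAKEXP : ∃ d n₁, ∀ n ≥ n₁, ∀ Cover(n, m, E, a), n ≤ (log₂ m + d)^d` (every label-bijective Pfaffian
  cover of `per_n` has size `m ≥ 2^(n^(1/d) - d)`), and
  `BALEX : ∃ n₂, ∀ n ≥ n₂, ∀ Cover, ∃ S, Bal(S)` (some vertex set is balanced for all weight-nonzero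
  perfect matchings at once).

So the line's load-bearing stub carries exactly the strength of a weakly-exponential lower bound for
Pfaffian covers — STRONGER than the crux `MonotoneCoverHard` (super-quasi-polynomial) — plus a side
condition; its cut/state vocabulary is a mechanism pointer, not a reduction.  VP ≠ VNP is not moved.
No definitions.
-/

namespace Summit.ValiantsHypothesis.ValiantsHypothesis.Theorems.PolyaContinuedMonotoneCoverHard

-- summit = sub-problem name (single-conjunct summit, D-0017 layout), so the namespace repeats it
set_option linter.dupNamespace false

open scoped Classical
open Finset
open Summit.ValiantsHypothesis.ValiantsHypothesis.Theorems.PolyaContinued.MonotoneCoverHardRectangle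
  (exists_labels aeval_permanent_cover perPoly_eq_sum_monomial label_bijection pexp_injective
    stub_rectangleBound)

/-- **COUNT.**  A cover of `per_n` (labels in `{X j, 0, 1}`, `per_n = aeval a PM_E`) has at most `n!`
weight-nonzero perfect matchings: the label-exponent map is injective on them with values among the
`n!` permutation exponents (`label_bijection`). -/
theorem card_good_le_factorial (n m : ℕ) (E : Finset (Fin m × Fin m))
    (a : Fin m × Fin m → MvPolynomial (Fin n × Fin n) ℂ)
    (ha : ∀ e, (∃ j, a e = MvPolynomial.X j) ∨ a e = 0 ∨ a e = 1)
    (hper : Literature.Computability.AlgebraicComplexity.perPoly (Fin n) ℂ =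
      MvPolynomial.aeval a (Matrix.of fun i j => if (i, j) ∈ E then MvPolynomial.X (i, j) else 0 :
          Matrix (Fin m) (Fin m) (MvPolynomial (Fin m × Fin m) ℂ)).permanent) :
    (Finset.univ.filter fun τ : Equiv.Perm (Fin m) => ∀ i, (i, τ i) ∈ E ∧ a (i, τ i) ≠ 0).card ≤
      n.factorial := by
  obtain ⟨δ, hδ, -, -⟩ := exists_labels a ha
  set G := Finset.univ.filter fun τ : Equiv.Perm (Fin m) => ∀ i, (i, τ i) ∈ E ∧ a (i, τ i) ≠ 0
    with hG
  have hsum : ∑ τ ∈ G, MvPolynomial.monomial (∑ i, δ (i, τ i)) (1 : ℂ) =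
      ∑ σ : Equiv.Perm (Fin n), MvPolynomial.monomial (∑ k, Finsupp.single (k, σ k) 1) (1 : ℂ) := by
    rw [← aeval_permanent_cover E a δ hδ G hG, ← hper, perPoly_eq_sum_monomial]
  obtain ⟨hinj, himg, -⟩ := label_bijection G (fun τ => ∑ i, δ (i, τ i))
    (fun σ : Equiv.Perm (Fin n) => ∑ k, Finsupp.single (k, σ k) (1 : ℕ)) pexp_injective hsum
  -- choose the permutation of each weight-nonzero matching
  set f : Equiv.Perm (Fin m) → Equiv.Perm (Fin n) := fun τ =>
    if h : τ ∈ G then (himg τ h).choose else 1 with hf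
  have hfspec : ∀ τ (h : τ ∈ G),
      (∑ i, δ (i, τ i)) = ∑ k, Finsupp.single (k, (f τ) k) (1 : ℕ) := by
    intro τ h
    simp only [hf, dif_pos h]
    exact (himg τ h).choose_spec
  calc G.card ≤ (Finset.univ : Finset (Equiv.Perm (Fin n))).card :=
        Finset.card_le_card_of_injOn f (fun _ _ => Finset.mem_coe.2 (Finset.mem_univ _))
          (fun τ hτ τ' hτ' hff => hinj τ hτ τ' hτ' (by
            rw [hfspec τ hτ, hfspec τ' hτ']
            exact congrArg (fun σ : Equiv.Perm (Fin n) => ∑ k, Finsupp.single (k, σ k) (1 : ℕ)) hff))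
    _ = n.factorial := by simp [Fintype.card_perm]

/-- **`stub_fewStateCut ⟺ WEAKEXP ∧ BALEX`.**  The registered (repaired) bet of line `few_state_cut`
is equivalent to the conjunction of a weakly-exponential size lower bound for label-bijective Pfaffian
covers of the permanent and the bare existence of a balanced vertex set.  (`→`: the rectangle stub
`stub_rectangleBound` turns few states into `n/3 ≤ (log₂ m + c)^c`; `←`: with such a size bound ANY
balanced vertex set has `≤ n! ≤ 2^((log₂ m + 2d+1)^(2d+1))` states by `card_good_le_factorial`.) -/
theorem stub_fewStateCut_iff_weakExp_and_balEx :
    (∃ c n₀ : ℕ, ∀ (n m : ℕ) (E : Finset (Fin m × Fin m))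
      (a : Fin m × Fin m → MvPolynomial (Fin n × Fin n) ℂ), n₀ ≤ n →
      (∃ s : Fin m × Fin m → ℂ, (∀ e, s e = 1 ∨ s e = -1) ∧
        (Matrix.of fun i j => if (i, j) ∈ E then MvPolynomial.C (s (i, j)) * MvPolynomial.X (i, j)
            else 0 : Matrix (Fin m) (Fin m) (MvPolynomial (Fin m × Fin m) ℂ)).det =
          (Matrix.of fun i j => if (i, j) ∈ E then MvPolynomial.X (i, j) else 0 :
            Matrix (Fin m) (Fin m) (MvPolynomial (Fin m × Fin m) ℂ)).permanent) →
      (∀ e, (∃ j, a e = MvPolynomial.X j) ∨ a e = 0 ∨ a e = 1) →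
      Literature.Computability.AlgebraicComplexity.perPoly (Fin n) ℂ =
        MvPolynomial.aeval a (Matrix.of fun i j => if (i, j) ∈ E then MvPolynomial.X (i, j) else 0 :
            Matrix (Fin m) (Fin m) (MvPolynomial (Fin m × Fin m) ℂ)).permanent →
      ∃ S : Finset (Fin m ⊕ Fin m),
        (∀ τ : Equiv.Perm (Fin m), (∀ i, (i, τ i) ∈ E ∧ a (i, τ i) ≠ 0) →
          n ≤ 3 * (Finset.univ.filter fun i : Fin m =>
              Sum.inl i ∈ S ∧ Sum.inr (τ i) ∈ S ∧ ∃ j, a (i, τ i) = MvPolynomial.X j).card ∧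
          3 * (Finset.univ.filter fun i : Fin m =>
              Sum.inl i ∈ S ∧ Sum.inr (τ i) ∈ S ∧ ∃ j, a (i, τ i) = MvPolynomial.X j).card ≤ 2 * n) ∧
        ((Finset.univ.filter fun τ : Equiv.Perm (Fin m) => ∀ i, (i, τ i) ∈ E ∧ a (i, τ i) ≠ 0).image
            (fun τ : Equiv.Perm (Fin m) => (Finset.univ.filter fun i : Fin m =>
              (Sum.inl i ∈ S ∧ Sum.inr (τ i) ∉ S) ∨ (Sum.inl i ∉ S ∧ Sum.inr (τ i) ∈ S)).image
                fun i => (i, τ i))).card ≤ 2 ^ ((Nat.log 2 m + c) ^ c)) ↔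
    ((∃ d n₁ : ℕ, ∀ (n m : ℕ) (E : Finset (Fin m × Fin m))
      (a : Fin m × Fin m → MvPolynomial (Fin n × Fin n) ℂ), n₁ ≤ n →
      (∃ s : Fin m × Fin m → ℂ, (∀ e, s e = 1 ∨ s e = -1) ∧
        (Matrix.of fun i j => if (i, j) ∈ E then MvPolynomial.C (s (i, j)) * MvPolynomial.X (i, j)
            else 0 : Matrix (Fin m) (Fin m) (MvPolynomial (Fin m × Fin m) ℂ)).det =
          (Matrix.of fun i j => if (i, j) ∈ E then MvPolynomial.X (i, j) else 0 :
            Matrix (Fin m) (Fin m) (MvPolynomial (Fin m × Fin m) ℂ)).permanent) →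
      (∀ e, (∃ j, a e = MvPolynomial.X j) ∨ a e = 0 ∨ a e = 1) →
      Literature.Computability.AlgebraicComplexity.perPoly (Fin n) ℂ =
        MvPolynomial.aeval a (Matrix.of fun i j => if (i, j) ∈ E then MvPolynomial.X (i, j) else 0 :
            Matrix (Fin m) (Fin m) (MvPolynomial (Fin m × Fin m) ℂ)).permanent →
      n ≤ (Nat.log 2 m + d) ^ d) ∧
    (∃ n₂ : ℕ, ∀ (n m : ℕ) (E : Finset (Fin m × Fin m))
      (a : Fin m × Fin m → MvPolynomial (Fin n × Fin n) ℂ), n₂ ≤ n →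
      (∃ s : Fin m × Fin m → ℂ, (∀ e, s e = 1 ∨ s e = -1) ∧
        (Matrix.of fun i j => if (i, j) ∈ E then MvPolynomial.C (s (i, j)) * MvPolynomial.X (i, j)
            else 0 : Matrix (Fin m) (Fin m) (MvPolynomial (Fin m × Fin m) ℂ)).det =
          (Matrix.of fun i j => if (i, j) ∈ E then MvPolynomial.X (i, j) else 0 :
            Matrix (Fin m) (Fin m) (MvPolynomial (Fin m × Fin m) ℂ)).permanent) →
      (∀ e, (∃ j, a e = MvPolynomial.X j) ∨ a e = 0 ∨ a e = 1) →
      Literature.Computability.AlgebraicComplexity.perPoly (Fin n) ℂ =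
        MvPolynomial.aeval a (Matrix.of fun i j => if (i, j) ∈ E then MvPolynomial.X (i, j) else 0 :
            Matrix (Fin m) (Fin m) (MvPolynomial (Fin m × Fin m) ℂ)).permanent →
      ∃ S : Finset (Fin m ⊕ Fin m),
        ∀ τ : Equiv.Perm (Fin m), (∀ i, (i, τ i) ∈ E ∧ a (i, τ i) ≠ 0) →
          n ≤ 3 * (Finset.univ.filter fun i : Fin m =>
              Sum.inl i ∈ S ∧ Sum.inr (τ i) ∈ S ∧ ∃ j, a (i, τ i) = MvPolynomial.X j).card ∧
          3 * (Finset.univ.filter fun i : Fin m =>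
              Sum.inl i ∈ S ∧ Sum.inr (τ i) ∈ S ∧ ∃ j, a (i, τ i) = MvPolynomial.X j).card ≤ 2 * n)) := by
  constructor
  · intro hbet
    refine ⟨weakExp_of_bet_of_rect hbet stub_rectangleBound, ?_⟩
    obtain ⟨c, n₀, hc⟩ := hbet
    refine ⟨n₀, fun n m E a hn hsig ha hper => ?_⟩
    obtain ⟨S, hbal, -⟩ := hc n m E a hn hsig ha hper
    exact ⟨S, hbal⟩
  · rintro ⟨hweak, hbalEx⟩
    exact bet_of_weakExp_of_balEx_of_count hweak hbalEx
      (fun n m E a ha hper => card_good_le_factorial n m E a ha hper)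

end Summit.ValiantsHypothesis.ValiantsHypothesis.Theorems.PolyaContinuedMonotoneCoverHard
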